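import Mathlib.Analysis.Matrix.Normed
import Literature.Analysis.FluidPDE.OnsagerBDSVGluing
import Literature.Analysis.FluidPDE.Antidivergence
import HarnessLib

/-!
# The BDSV scheme: the perturbation stage decomposed (§§5–6 as named facts, and their assembly)

Buckmaster–De Lellis–Székelyhidi–Vicol (BDSV), *Onsager's conjecture for admissible weak
solutions*, CPAM 72 (2019) = arXiv:1701.08678. The named fact `BDSV.perturbationStage`
(`OnsagerBDSVThreeStages.lean`) is the whole perturbation step of the scheme — §5 (Mikado flows,
squiggling cut-offs, backward flows, the perturbation `w_{q+1} = w_o + w_c`, the new stress and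
pressure) and §6 (Props. 6.1, 6.2), resting on App. A–C. This file DECOMPOSES it along the
source's own architecture into seven named facts and PROVES the assembly
`BDSV.perturbationStage_of_parts : F₁ → ⋯ → F₇ → BDSV.perturbationStage`:

* data of the construction, each a structure carrying exactly the printed properties:
  `BDSV.MikadoDatum` (Lemma 5.1 with the potential (5.9)), `BDSV.CutoffFamily` (§5.2 (i)–(v) and
  Lemma 5.3), `BDSV.FlowDisplacement` (the backward flows `Φ_i = id + D_i` of §5.2);
* the construction of §5 as honest definitions: `ρ_q`, `ρ_{q,i}`, `∇Φ_i`, `R̃_{q,i}` ((5.17) in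
  the form (5.32)), the perturbation `w_{q+1}` in its curl form (5.28)
  (`BDSV.perturbation = n_{q+1}⁻¹ curl BDSV.potential`, with `BDSV.curl` of
  `OnsagerBDSVGluing.lean`), `R̄_q = ∑_i R_{q,i}`, the new stress
  (5.23) `R̊_{q+1} = ℛ(∂ₜw + v̄·∇w + w·∇v̄ + div(w ⊗ w - R̄_q))` through the tree's De Lellis–
  Székelyhidi antidivergence `Torus.antidivergence` (BDSV (4.1), Prop. 4.1), and the new pressure;
* F₁ `BDSV.mikado_exists` (Lemma 5.1), F₂ `BDSV.cutoffs_exist` (Lemma 5.3),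
  F₃ `BDSV.backwardFlow_exists` (§5.2 / App. B), F₄ `BDSV.incrementEstimate` (Cor. 5.8 (5.31)
  with Def. 5.6), F₅ `BDSV.newTriple_isEulerReynolds` (§5.4), F₆ `BDSV.stressEstimate`
  (Prop. 6.1 (6.1)), F₇ `BDSV.energyEstimate` (Prop. 6.2) — F₄–F₇ share the quantifier prefix
  of `BDSV.perturbationStage` (`BDSV.PerturbationHypotheses` bundles its standing hypotheses) and
  are universally quantified over the construction data (`BDSV.PerturbationData`).

## Design choices

* Periods. BDSV's spatial torus is `ℝ³/ℤ³` while the Mikado profiles `W(R, ξ) = ∑ a_k(R) A_k e^{ik·ξ}`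
  are `2π`-periodic and are composed with `λ_{q+1} Φ_i`, `λ_{q+1} = 2π⌈a^{b^{q+1}}⌉ ∈ 2πℕ`. Here
  the profiles live on `UnitAddTorus (Fin 3)` and are composed with `n_{q+1} • Φ_i`,
  `n_{q+1} = ⌈a^{b^{q+1}}⌉` (`BDSV.Params.freqNat`) — the same functions.
* Flow maps are recorded by their periodic displacement `D = Φ - id : [0,T] × T³ → ℝ³`
  (`Φ(x + k) = Φ(x) + k`), so that `∇Φ = Id + ∇D`, `Φ(t, x) = x + D(t, x) mod ℤ³`, and the
  transport equation reads `∂ₜD + (v·∇)D + v = 0`; the flow `Φ_i` is anchored at `min(t_i, T)`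
  (`= t_i` whenever `t_i ≤ T`, as in the source; the last cut-off may have `t_i > T`).
* Only the curl form (5.28) of `w_{q+1}` is needed to STATE the facts (the split `w_o + w_c`,
  the Fourier coefficients `a_k, A_k, C_k`, `b_{i,k}`, `c_{i,k}` belong to the proofs of
  Cor. 5.8 and Props. 6.1–6.2); by the pull-back identity
  `curl(∇Φᵀ U∘Φ) = (det ∇Φ) ∇Φ⁻¹ (curl U)∘Φ` it equals (5.20) + (5.27).
* `R̃_{q,i}` is defined by (5.32), `∇Φ_i (Id - (∑_j∫η_j²/ρ_q) R̊̄_q) ∇Φ_iᵀ`, which agrees with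
  (5.17) on `supp η_i` and avoids a division by `η_i²`; `ρ_{q,i}^{1/2}` is `η_i (ρ_q/∑∫η_j²)^{1/2}`.
* The new stress is `ℛ` of the SUM of the three source terms of (5.23) (`ℛ` is linear). The
  pressure balancing (5.23) as printed is `p̄_q + ρ_q - ∑_i ρ_{q,i}` (`BDSV.newPressure`, mean
  zero); the display (5.24) prints `p̄_q + |w_{q+1}|² - ∑_i ρ_{q,i}`, whose extra `|w_{q+1}|²`
  belongs to a variant of (5.23) with the trace of `w ⊗ w` moved into the pressure — with (5.23)
  as printed it would leave `∇|w_{q+1}|²` unbalanced. F₅ is stated for the consistent pair.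
* Mikado flows are taken on the compact neighbourhood `{R = Rᵀ : ‖R - Id‖_∞ ≤ 1/10}` of `Id`
  (`BDSV.mikadoRadius`; BDSV: `B̄_{1/2}(Id)` — any fixed neighbourhood works, Lemma 5.4), inside
  which the tree's `NashGeometric.geometric_lemma` applies; matrices are `Matrix (Fin 3) (Fin 3) ℝ`
  with the elementwise sup norm (`open scoped Matrix.Norms.Elementwise`).
* The universal constant `M` of Prop. 2.1 is, as in Def. 5.6, a function of the Mikado profile
  and of `c₀` only: F₄ has the prefix `∀ 𝔚 c₀, ∃ M, ∀ (everything else)`.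
* Junk values (irrelevant under the facts' thresholds `a ≥ a₀`): `Real.sqrt` of a negative
  number and division by `∑∫η_j² = 0` give `0`.

## What is not here

The proofs of F₁–F₇ (Lemma 5.1 from the geometric lemma and disjoint pipes; Lemma 5.3 by
mollifying squiggling indicators; backward flows from `Literature/Analysis/ODE`; §5.4 by
`Torus.tensorDivergence_antidivergence`; Cor. 5.8 and Props. 6.1–6.2 through Props. 5.7, 5.9,
Lemma 5.4 and App. A–C: Hölder interpolation/composition (Prop. A.1), transport and flow estimates
(Prop. B.1), Calderón–Zygmund and stationary-phase estimates for `ℛ` (Props. C.1–C.2)) — each is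
the subject of later files; `BDSV.perturbationStage_holds` then follows from
`BDSV.perturbationStage_of_parts`.

## References

* T. Buckmaster, C. De Lellis, L. Székelyhidi Jr., V. Vicol, *Onsager's conjecture for admissible
  weak solutions*, Comm. Pure Appl. Math. 72 (2019) 229–274 = arXiv:1701.08678: §5.1 Lemma 5.1,
  (5.7)–(5.9); §5.2 (i)–(v), Lemma 5.3, `ρ_q`, `ρ_{q,i}`, `Φ_i`, `R_{q,i}`, (5.17), Lemma 5.4;
  §5.3 (5.20)–(5.28), Lemma 5.5, Def. 5.6; §5.4 (5.23)–(5.24); §5.5 Prop. 5.7, Cor. 5.8, Prop. 5.9;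
  §6.1 Prop. 6.1, §6.1.1; §6.2 Prop. 6.2; App. B Prop. B.1; App. C Props. C.1–C.2.
* S. Daneri, L. Székelyhidi Jr., *Non-uniqueness and h-principle for Hölder-continuous weak
  solutions of the Euler equations*, ARMA 224 (2017) = arXiv:1603.09714, Lemma 2.3 (Mikado flows),
  Lemma 2.2 (stationary phase), Def. 2.1 (the operator `ℛ`).
* C. De Lellis, L. Székelyhidi Jr., *Dissipative continuous Euler flows*, Invent. Math. 193 (2013),
  §4 (the operator `ℛ`).
-/

open MeasureTheory Set
open scoped NNReal ENNReal ContDiff Matrix Matrix.Norms.Elementwise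

noncomputable section

namespace Literature.Analysis.FluidPDE

namespace BDSV

open FunctionSpaces FunctionSpaces.Torus

/-- The flat three-torus `T³ = (ℝ/ℤ)³`, local notation. -/
local notation "𝕋³" => UnitAddTorus (Fin 3)

/-- Euclidean `ℝ³`, local notation. -/
local notation "ℝ³" => EuclideanSpace ℝ (Fin 3)

/-- Real `3 × 3` matrices, local notation. -/
local notation "𝕄" => Matrix (Fin 3) (Fin 3) ℝ

/-! ## A matrix helper -/

section Helpers

/-- The matrix with columns `S j ∈ ℝ³` (the column convention of `Torus.tensorDivergence` /
`Torus.IsEulerReynoldsOn` for `2`-tensors): `(ofCols S) i j = (S j) i`. Matrix–vector products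
`A v`, `v ∈ ℝ³ = EuclideanSpace ℝ (Fin 3)`, are Mathlib's `Matrix.toEuclideanLin A v`; the curl on
`T³` is `BDSV.curl` (`OnsagerBDSVGluing.lean`). [folklore] -/
def ofCols (S : Fin 3 → ℝ³) : 𝕄 := Matrix.of fun i j => S j i

/-- Entries of `ofCols`. [folklore] -/
@[simp] theorem ofCols_apply (S : Fin 3 → ℝ³) (i j : Fin 3) : ofCols S i j = S j i := rfl

end Helpers

/-! ## Mikado flows (Lemma 5.1) as a datum -/

section Mikado

/-- The radius of the (sup-norm) ball of symmetric matrices about `Id` on which the Mikado flows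
are used: `𝒩 = {R symmetric : maxᵢⱼ |Rᵢⱼ - δᵢⱼ| ≤ 1/10} ⊂ 𝒮₊^{3×3}` (BDSV take the ball
`B̄_{1/2}(Id)`, §5.3; any fixed neighbourhood of `Id` serves, Lemma 5.4 giving
`|R̃_{q,i} - Id| ≲ ℓ^α`; `1/10` is the radius `r₃ = 1/(5·2)` of the tree's geometric lemma
`NashGeometric.geometric_lemma`). [cite: BuckmasterEtAl2018, §5.3 (choice of 𝒩)] -/
def mikadoRadius : ℝ := 1 / 10

/-- **Mikado flows on a neighbourhood of the identity, as a datum** (BDSV Lemma 5.1 =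
Daneri–Székelyhidi 2017, Lemma 2.3, for the compact set
`𝒩 = {R = Rᵀ, ‖R - Id‖_∞ ≤ r} ⊂ 𝒮₊^{3×3}`, together with the vector potential of (5.9)):
a smooth family of smooth vector fields `W(R, ·)` on `T³`, `R ∈ 𝒩`, with
`div_ξ (W ⊗ W) = 0` (equivalently, given `div_ξ W = 0`: `(W·∇_ξ)W = 0`), `div_ξ W = 0`,
`⨍ W = 0`, `⨍ W ⊗ W = R`, and a smooth family `V(R, ·)` of divergence-free mean-zero potentials,
`curl_ξ V = W` ((5.9): `V = ∑ₖ aₖ(R) (ik × Aₖ)/|k|² e^{ik·ξ}`). The period is normalised to `1`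
(`T³ = (ℝ/ℤ)³`; BDSV's profiles are `2π`-periodic and are evaluated at `λ_{q+1} Φ` with
`λ_{q+1} ∈ 2πℕ`, which is the same thing). Smoothness is required on all of `𝕄 × ℝ³` (a smooth
cut-off in `R` off `𝒩` changes nothing on `𝒩`); the identities only on `𝒩`.
[cite: BuckmasterEtAl2018, Lemma 5.1 and (5.9)] -/
structure MikadoDatum (r : ℝ) where
  /-- The Mikado flows `W(R, ξ)`. -/
  W : 𝕄 → 𝕋³ → ℝ³
  /-- The vector potential `V(R, ξ)` with `curl_ξ V = W`. -/
  V : 𝕄 → 𝕋³ → ℝ³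
  /-- `W` is jointly smooth in `(R, ξ)`. -/
  smooth_W : ContDiff ℝ ∞ fun p : 𝕄 × ℝ³ => W p.1 (proj p.2)
  /-- `V` is jointly smooth in `(R, ξ)`. -/
  smooth_V : ContDiff ℝ ∞ fun p : 𝕄 × ℝ³ => V p.1 (proj p.2)
  /-- `div_ξ W(R, ·) = 0`. -/
  divFree_W : ∀ R ∈ Metric.closedBall (1 : 𝕄) r, R.IsSymm → IsDivFree (W R)
  /-- `div_ξ (W ⊗ W) = (W·∇_ξ) W = 0`: `W(R, ·)` is a stationary pressureless Euler flow. -/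
  convect_W : ∀ R ∈ Metric.closedBall (1 : 𝕄) r, R.IsSymm → ∀ ξ, convect (W R) (W R) ξ = 0
  /-- `⨍ W(R, ξ) dξ = 0`. -/
  integral_W : ∀ R ∈ Metric.closedBall (1 : 𝕄) r, R.IsSymm → ∫ ξ, W R ξ = 0
  /-- `⨍ W ⊗ W dξ = R`. -/
  integral_WW : ∀ R ∈ Metric.closedBall (1 : 𝕄) r, R.IsSymm →
    ∀ i j : Fin 3, ∫ ξ, W R ξ i * W R ξ j = R i j
  /-- `curl_ξ V = W`. -/
  curl_V : ∀ R ∈ Metric.closedBall (1 : 𝕄) r, R.IsSymm → ∀ ξ, curl (V R) ξ = W R ξ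
  /-- `div_ξ V = 0`. -/
  divFree_V : ∀ R ∈ Metric.closedBall (1 : 𝕄) r, R.IsSymm → IsDivFree (V R)
  /-- `⨍ V = 0`. -/
  integral_V : ∀ R ∈ Metric.closedBall (1 : 𝕄) r, R.IsSymm → ∫ ξ, V R ξ = 0

end Mikado

/-! ## Squiggling cut-offs (Lemma 5.3) and backward flows (§5.2) as data -/

section Cutoffs

/-- The number of cut-offs `η_i`, `i = 0, 1, …`, that can meet `[0,T]`: `η_i` lives on
`(t_i - τ/3, t_{i+1} + τ/3)`, `t_i = iτ`, so `i ≤ T/τ + 1/3`; we sum over `i < ⌈T/τ⌉₊ + 2`. [folklore] -/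
def cutoffCount (T τ : ℝ) : ℕ := ⌈T / τ⌉₊ + 2

/-- **The squiggling space–time cut-offs of BDSV §5.2, as a datum** (properties (i)–(v) of §5.2
and the bounds of Lemma 5.3): `η_i ∈ C^∞(T³ × [0,T])`, `0 ≤ η_i ≤ 1`; pairwise disjoint supports
(pointwise: `η_i η_j = 0`); `η_i = 1` on `T³ × I_i`, `I_i = [t_i + τ/3, t_i + 2τ/3] ∩ [0,T]`,
`t_i = iτ`; `supp η_i ⊂ T³ × (t_i - τ/3, t_{i+1} + τ/3)`; `∑_i ∫ η_i²(x,t) dx ≥ c₀` for all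
`t ∈ [0,T]`; and `‖∂ₜⁿ η_i‖_m ≤ C(n,m) τ^{-n}` (spatial `C^m` norms of the `n`-th one-sided time
derivative within `[0,T]`, by `BDSV.HolderSupLE`). Indices `i ∈ ℕ` (`t_i ≥ 0` suffices to cover
`[0,T]`); sums over `i` run over `i < cutoffCount T τ`, which by the support property loses
nothing on `[0,T]`. [cite: BuckmasterEtAl2018, §5.2 (i)–(v) and Lemma 5.3] -/
structure CutoffFamily (T τ c₀ : ℝ) (Cη : ℕ → ℕ → ℝ) where
  /-- The cut-offs `η_i (t, x)`. -/
  η : ℕ → ℝ → 𝕋³ → ℝ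
  /-- (i) each `η_i` is jointly smooth on `[0,T] × T³`. -/
  smooth : ∀ i, IsSmoothSpaceTimeOn (Icc 0 T) (η i)
  /-- (i) `0 ≤ η_i`. -/
  nonneg : ∀ i t x, 0 ≤ η i t x
  /-- (i) `η_i ≤ 1`. -/
  le_one : ∀ i t x, η i t x ≤ 1
  /-- (ii) the supports are pairwise disjoint. -/
  disjoint : ∀ i j, i ≠ j → ∀ t x, η i t x = 0 ∨ η j t x = 0
  /-- (iii) `η_i = 1` on `I_i × T³`, `I_i = [t_i + τ/3, t_i + 2τ/3] ∩ [0,T]`. -/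
  eq_one : ∀ i : ℕ, ∀ t ∈ Icc 0 T, t ∈ Icc ((i : ℝ) * τ + τ / 3) ((i : ℝ) * τ + 2 * τ / 3) →
    ∀ x, η i t x = 1
  /-- (iv) `supp η_i ⊂ (t_i - τ/3, t_{i+1} + τ/3) × T³`. -/
  support : ∀ (i : ℕ) t x, η i t x ≠ 0 → (i : ℝ) * τ - τ / 3 < t ∧ t < ((i : ℝ) + 1) * τ + τ / 3
  /-- (v) `∑_i ∫ η_i² ≥ c₀` on `[0,T]`. -/
  sum_sq_ge : ∀ t ∈ Icc 0 T, c₀ ≤ ∑ i ∈ Finset.range (cutoffCount T τ), ∫ x, η i t x ^ 2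
  /-- Lemma 5.3: `‖∂ₜⁿ η_i‖_m ≤ C(n,m) τ^{-n}`. -/
  deriv_le : ∀ i n m, HolderSupLE T ((timeDerivWithin (Icc 0 T))^[n] (η i)) m 0
    (Cη n m * τ ^ (-(n : ℝ)))

/-- **Backward flow of a velocity field, as a datum** (BDSV §5.2: "Define the backward flows
`Φ_i` for the velocity field `v̄_q` as the solution of the transport equation
`(∂ₜ + v̄_q·∇) Φ_i = 0`, `Φ_i(x, t_i) = x`"), recorded through the periodic displacement
`D = Φ - id`: `D : [0,T] × T³ → ℝ³` jointly smooth, `D(t₀, ·) = 0`, and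
`∂ₜ D + (v·∇) D + v = 0` on `[0,T] × T³` (which is the transport equation for `Φ = id + D`,
since `(v·∇) id = v`); then `∇Φ = Id + ∇D` and `Φ(t, x) = x + D(t, x) mod ℤ³`.
[cite: BuckmasterEtAl2018, §5.2 (backward flows Φ_i)] -/
structure FlowDisplacement (T : ℝ) (v : ℝ → 𝕋³ → ℝ³) (t₀ : ℝ) where
  /-- The displacement `D = Φ - id`. -/
  D : ℝ → 𝕋³ → ℝ³
  /-- `D` is jointly smooth on `[0,T] × T³`. -/
  smooth : IsSmoothSpaceTimeOn (Icc 0 T) D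
  /-- `Φ(t₀, ·) = id`. -/
  anchor : ∀ x, D t₀ x = 0
  /-- `(∂ₜ + v·∇) Φ = 0`, i.e. `∂ₜ D + (v·∇) D + v = 0`, on `[0,T] × T³`. -/
  transport : ∀ t ∈ Icc 0 T, ∀ x,
    timeDerivWithin (Icc 0 T) D t x + convect (v t) (D t) x + v t x = 0

end Cutoffs

/-! ## The construction of §5 (curl form (5.28); new stress (5.23); new pressure) -/

section Construction

/-- The parameters `β, α, a, b` of the scheme (§2.1, §2.4). [cite: BuckmasterEtAl2018, §2.1] -/
structure Params where
  /-- The target Hölder exponent `β ∈ (0, 1/3)`. -/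
  β : ℝ
  /-- The small parameter `α > 0`. -/
  α : ℝ
  /-- The large parameter `a > 1`. -/
  a : ℝ
  /-- The parameter `b > 1` (`λ_q ∼ a^{b^q}`). -/
  b : ℝ

/-- The inputs of the perturbation step at stage `q` (§2.6, §5): the time horizon `T`, the energy
profile `e`, the stage `q` and the glued Euler–Reynolds triple `(v̄_q, p̄_q, R̊̄_q)`.
[cite: BuckmasterEtAl2018, §2.6] -/
structure Setting where
  /-- The time horizon `T > 0`. -/
  T : ℝ
  /-- The (normalised) energy profile `e`. -/
  e : ℝ → ℝ
  /-- The stage `q`. -/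
  q : ℕ
  /-- The glued velocity `v̄_q`. -/
  vbar : ℝ → 𝕋³ → ℝ³
  /-- The glued pressure `p̄_q`. -/
  pbar : ℝ → 𝕋³ → ℝ
  /-- The glued Reynolds stress `R̊̄_q` (columns). -/
  Rbar : ℝ → 𝕋³ → Fin 3 → ℝ³

variable (P : Params) (S : Setting)

/-- The gluing time scale `τ_q = ℓ^{2α} δ_q^{-1/2} λ_q^{-1}` of the setting (`BDSV.glueScale`).
[cite: BuckmasterEtAl2018, §2.5 (2.16)] -/
def Params.τ (P : Params) (q : ℕ) : ℝ := glueScale P.β P.α P.a P.b q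

/-- The integer `n_q = ⌈a^{b^q}⌉`, so that `λ_q = 2π n_q` (`BDSV.freq`, `Params.freq_eq`): the
`1`-periodic Mikado profiles are composed with `n_{q+1} Φ_i`, which is BDSV's `W(·, λ_{q+1}Φ_i)`
for their `2π`-periodic profiles. [cite: BuckmasterEtAl2018, §2.1 (λ_q) and (5.20)] -/
def Params.freqNat (P : Params) (q : ℕ) : ℕ := ⌈P.a ^ (P.b ^ q)⌉₊

/-- `λ_q = 2π n_q` for `a ≥ 0` (`BDSV.freq` uses `Int.ceil`, `Params.freqNat` uses `Nat.ceil`;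
they agree on the nonnegative number `a^{b^q}`). [folklore] -/
theorem Params.freq_eq (P : Params) (ha : 0 ≤ P.a) (q : ℕ) :
    freq P.a P.b q = 2 * Real.pi * (P.freqNat q : ℝ) := by
  rw [freq, Params.freqNat, ← Int.cast_natCast, Int.natCast_ceil_eq_ceil (Real.rpow_nonneg ha _)]

/-- `ρ_q(t) = ⅓ (e(t) - δ_{q+2}/2 - ∫_{T³} |v̄_q|² dx)` (§5.2). [cite: BuckmasterEtAl2018, §5.2 (ρ_q)] -/
def rhoQ (t : ℝ) : ℝ :=
  (S.e t - amp P.β P.a P.b (S.q + 2) / 2 - ∫ x, ‖S.vbar t x‖ ^ 2) / 3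

/-- `∑_j ∫_{T³} η_j²(y, t) dy`, the normalising mass in `ρ_{q,i}` (§5.2). [cite: BuckmasterEtAl2018, §5.2 (ρ_{q,i})] -/
def etaMass (η : ℕ → ℝ → 𝕋³ → ℝ) (t : ℝ) : ℝ :=
  ∑ j ∈ Finset.range (cutoffCount S.T (P.τ S.q)), ∫ y, η j t y ^ 2

/-- `ρ_{q,i}(x,t) = η_i²(x,t) ρ_q(t) / ∑_j ∫ η_j²(y,t) dy` (§5.2). [cite: BuckmasterEtAl2018, §5.2 (ρ_{q,i})] -/
def rhoI (η : ℕ → ℝ → 𝕋³ → ℝ) (i : ℕ) (t : ℝ) (x : 𝕋³) : ℝ :=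
  η i t x ^ 2 * (rhoQ P S t / etaMass P S η t)

/-- `ρ_{q,i}^{1/2} = η_i (ρ_q / ∑_j ∫ η_j²)^{1/2}` (the smooth square root of `ρ_{q,i}` used in
(5.20): `η_i ≥ 0` and, under (5.2), `ρ_q > 0`). Junk: `Real.sqrt` of a negative number is `0`.
[cite: BuckmasterEtAl2018, §5.3 (5.20)] -/
def sqrtRhoI (η : ℕ → ℝ → 𝕋³ → ℝ) (i : ℕ) (t : ℝ) (x : 𝕋³) : ℝ :=
  η i t x * Real.sqrt (rhoQ P S t / etaMass P S η t)

/-- `∇Φ_i = Id + ∇D_i` (entries `(∇Φ)_{ab} = δ_{ab} + ∂_b D_a`), the deformation matrix of the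
backward flow `Φ_i = id + D_i`. [cite: BuckmasterEtAl2018, §5.2 (Φ_i)] -/
def gradPhi (D : ℕ → ℝ → 𝕋³ → ℝ³) (i : ℕ) (t : ℝ) (x : 𝕋³) : 𝕄 :=
  1 + Matrix.of fun a b => partialDeriv b (D i t) x a

/-- The point `Φ_i(x, t) = x + D_i(x, t) (mod ℤ³) ∈ T³`. [cite: BuckmasterEtAl2018, §5.2 (Φ_i)] -/
def phiPoint (D : ℕ → ℝ → 𝕋³ → ℝ³) (i : ℕ) (t : ℝ) (x : 𝕋³) : 𝕋³ :=
  x + proj (D i t x)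

/-- `R̃_{q,i} = ∇Φ_i (Id - (∑_j ∫η_j² / ρ_q) R̊̄_q) ∇Φ_iᵀ` — the form (5.32) of
`R̃_{q,i} = ∇Φ_i R_{q,i} ∇Φ_iᵀ / ρ_{q,i}` (5.17), valid on `supp η_i` (off `supp η_i` it is
multiplied by `ρ_{q,i}^{1/2} = 0` wherever used). [cite: BuckmasterEtAl2018, §5.2 (5.17), §5.5 (5.32)] -/
def tildeR (η : ℕ → ℝ → 𝕋³ → ℝ) (D : ℕ → ℝ → 𝕋³ → ℝ³) (i : ℕ) (t : ℝ) (x : 𝕋³) : 𝕄 :=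
  gradPhi D i t x * (1 - (etaMass P S η t / rhoQ P S t) • ofCols (S.Rbar t x)) * (gradPhi D i t x)ᵀ

/-- The vector potential of the perturbation,
`Z = ∑_i ρ_{q,i}^{1/2} ∇Φ_iᵀ V(R̃_{q,i}, n_{q+1} Φ_i)` (the field under the curl in (5.28):
with `b_{i,k} = ρ_{q,i}^{1/2} a_k(R̃_{q,i}) A_k` and `V = ∑_k a_k (ik × A_k)/|k|² e^{ik·ξ}`,
`∑_k ∇Φ_iᵀ (ik × b_{k,i})/|k|² e^{iλ_{q+1} k·Φ_i} = ρ_{q,i}^{1/2} ∇Φ_iᵀ V(R̃_{q,i}, λ_{q+1}Φ_i)`).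
[cite: BuckmasterEtAl2018, §5.3 (5.28)] -/
def potential (𝔚 : MikadoDatum mikadoRadius) (η : ℕ → ℝ → 𝕋³ → ℝ) (D : ℕ → ℝ → 𝕋³ → ℝ³)
    (t : ℝ) (x : 𝕋³) : ℝ³ :=
  ∑ i ∈ Finset.range (cutoffCount S.T (P.τ S.q)),
    sqrtRhoI P S η i t x •
      Matrix.toEuclideanLin (gradPhi D i t x)ᵀ
        (𝔚.V (tildeR P S η D i t x) (P.freqNat (S.q + 1) • phiPoint D i t x))

/-- **The perturbation `w_{q+1} = w_o + w_c`** in its curl form (5.28),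
`w_{q+1} = λ_{q+1}^{-1} curl ∑_{i,k} ∇Φ_iᵀ (ik × b_{k,i})/|k|² e^{iλ_{q+1}k·Φ_i}
 = n_{q+1}^{-1} curl Z` with the `1`-periodic potential `Z = BDSV.potential` (the factor
`λ_{q+1} = 2π n_{q+1}` of BDSV becomes `n_{q+1}` for `1`-periodic profiles; the overall sign is
immaterial and follows (5.9)). [cite: BuckmasterEtAl2018, §5.3 (5.20), (5.27), (5.28)] -/
def perturbation (𝔚 : MikadoDatum mikadoRadius) (η : ℕ → ℝ → 𝕋³ → ℝ) (D : ℕ → ℝ → 𝕋³ → ℝ³)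
    (t : ℝ) (x : 𝕋³) : ℝ³ :=
  ((P.freqNat (S.q + 1) : ℝ))⁻¹ • curl (potential P S 𝔚 η D t) x

/-- The stress `R̄_q = ∑_i R_{q,i}`, `R_{q,i} = ρ_{q,i} Id - η_i² R̊̄_q` (§5.2–5.3), by columns.
[cite: BuckmasterEtAl2018, §5.2 (R_{q,i}), §5.3 (R̄_q)] -/
def stressSum (η : ℕ → ℝ → 𝕋³ → ℝ) (t : ℝ) (x : 𝕋³) (j : Fin 3) : ℝ³ :=
  ∑ i ∈ Finset.range (cutoffCount S.T (P.τ S.q)),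
    (rhoI P S η i t x • EuclideanSpace.single j (1 : ℝ) - η i t x ^ 2 • S.Rbar t x j)

/-- The new velocity `v_{q+1} = v̄_q + w_{q+1}` (§5). [cite: BuckmasterEtAl2018, §5 (v_{q+1})] -/
def newVelocity (𝔚 : MikadoDatum mikadoRadius) (η : ℕ → ℝ → 𝕋³ → ℝ) (D : ℕ → ℝ → 𝕋³ → ℝ³)
    (t : ℝ) (x : 𝕋³) : ℝ³ :=
  S.vbar t x + perturbation P S 𝔚 η D t x

/-- The vector field whose antidivergence is the new stress (5.23):
`F = ∂ₜ w + (v̄·∇) w + (w·∇) v̄ + div (w ⊗ w - R̄_q)` (transport + Nash + oscillation terms;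
`(w ⊗ w)` has columns `w_j w`). [cite: BuckmasterEtAl2018, §5.4 (5.23)] -/
def stressSource (𝔚 : MikadoDatum mikadoRadius) (η : ℕ → ℝ → 𝕋³ → ℝ) (D : ℕ → ℝ → 𝕋³ → ℝ³)
    (t : ℝ) (x : 𝕋³) : ℝ³ :=
  timeDerivWithin (Icc 0 S.T) (perturbation P S 𝔚 η D) t x +
    convect (S.vbar t) (perturbation P S 𝔚 η D t) x +
    convect (perturbation P S 𝔚 η D t) (S.vbar t) x +
    Torus.tensorDivergence
      (fun y j => perturbation P S 𝔚 η D t y j • perturbation P S 𝔚 η D t y - stressSum P S η t y j) x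

/-- **The new Reynolds stress** (5.23),
`R̊_{q+1} = ℛ(w·∇v̄_q) + ℛ(∂ₜw + v̄_q·∇w) + ℛ div(w ⊗ w - R̄_q) = ℛ F` with the
De Lellis–Székelyhidi antidivergence `ℛ = Torus.antidivergence` (BDSV (4.1), Prop. 4.1; `ℛ` is
linear), stored by columns. [cite: BuckmasterEtAl2018, §5.4 (5.23)] -/
def newStress (𝔚 : MikadoDatum mikadoRadius) (η : ℕ → ℝ → 𝕋³ → ℝ) (D : ℕ → ℝ → 𝕋³ → ℝ³)
    (t : ℝ) : 𝕋³ → Fin 3 → ℝ³ :=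
  Torus.antidivergence (stressSource P S 𝔚 η D t)

/-- **The new pressure** `p_{q+1} = p̄_q + ρ_q(t) - ∑_i ρ_{q,i}` (mean zero since
`∑_i ∫ ρ_{q,i} = ρ_q`). This is the pressure that balances (5.23) as printed:
`div R̊_{q+1} = F` forces `∇(p_{q+1} - p̄_q) = -∇ ∑_i ρ_{q,i}`; the display (5.24) of the source,
`p_{q+1} = p̄_q + |w_{q+1}|² - ∑_i ρ_{q,i}`, carries an extra `|w_{q+1}|²` that belongs to a
variant of (5.23) in which the trace part of `w ⊗ w` is moved into the pressure.
[cite: BuckmasterEtAl2018, §5.4 (5.24)] -/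
def newPressure (η : ℕ → ℝ → 𝕋³ → ℝ) (t : ℝ) (x : 𝕋³) : ℝ :=
  S.pbar t x + rhoQ P S t - ∑ i ∈ Finset.range (cutoffCount S.T (P.τ S.q)), rhoI P S η i t x

end Construction

/-! ## The standing hypotheses of the perturbation step -/

section Hypotheses

/-- The standing hypotheses of the perturbation step at stage `q` (the inputs listed at the start
of §2.6 and used throughout §§5–6), for the parameters `P = (β, α, a, b)`, the setting
`S = (T, e, q, v̄_q, p̄_q, R̊̄_q)`, a number of derivatives `N̄` and constants `C_in, C₀`:
`T > 0`; `e` is a normalised profile (2.1); `(v̄_q, p̄_q, R̊̄_q)` is an Euler–Reynolds triple on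
`[0,T] × T³` with (2.17) `supp R̊̄_q ⊂ ⋃ₙ Iₙ × T³`; `‖v̄_q‖₀ ≤ C₀` (used in Prop. 5.9); the
estimates (2.19)–(2.21) for `N ≤ N̄` with constant `C_in`; and the energy gap (5.2)
`δ_{q+1}/(2λ_q^α) ≤ e(t) - ∫ |v̄_q|² ≤ 2δ_{q+1}` on `[0,T]`. These are exactly the hypotheses of
`BDSV.perturbationStage`. [cite: BuckmasterEtAl2018, §2.6 (2.17)–(2.22), (5.2)] -/
structure PerturbationHypotheses (P : Params) (S : Setting) (Nbar : ℕ) (Cin C₀ : ℝ) : Prop where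
  /-- `0 < T`. -/
  pos_T : 0 < S.T
  /-- `e` is a normalised energy profile on `[0,T]` (2.1). -/
  profile : IsNormalisedProfile S.T S.e
  /-- `(v̄_q, p̄_q, R̊̄_q)` solves Euler–Reynolds on `[0,T] × T³`. -/
  eulerReynolds : Torus.IsEulerReynoldsOn (Icc 0 S.T) S.vbar S.pbar S.Rbar
  /-- (2.17) `supp R̊̄_q ⊂ ⋃ₙ Iₙ × T³`. -/
  stress_support : SupportedOnGlueIntervals S.T (glueScale P.β P.α P.a P.b S.q) S.Rbar
  /-- `‖v̄_q‖₀ ≤ C₀`. -/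
  velocity_sup : SupLE S.T S.vbar C₀
  /-- (2.19) `‖v̄_q‖_{1+N} ≤ C_in δ_q^{1/2} λ_q ℓ^{-N}` for `N ≤ N̄`. -/
  velocity : ∀ N : ℕ, N ≤ Nbar → HolderSupLE S.T S.vbar (N + 1) 0
    (Cin * (Real.sqrt (amp P.β P.a P.b S.q) * freq P.a P.b S.q *
      mollScale P.β P.α P.a P.b S.q ^ (-(N : ℝ))))
  /-- (2.20) `‖R̊̄_q‖_{N+α} ≤ C_in δ_{q+1} ℓ^{-N+α}` for `N ≤ N̄`. -/
  stress : ∀ N : ℕ, N ≤ Nbar → HolderSupLE S.T S.Rbar N (Real.toNNReal P.α)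
    (Cin * (amp P.β P.a P.b (S.q + 1) * mollScale P.β P.α P.a P.b S.q ^ (-(N : ℝ) + P.α)))
  /-- (2.21) `‖(∂ₜ + v̄_q·∇) R̊̄_q‖_{N+α} ≤ C_in δ_{q+1} δ_q^{1/2} λ_q ℓ^{-N-α}` for `N ≤ N̄`. -/
  transport : ∀ N : ℕ, N ≤ Nbar →
    HolderSupLE S.T (advectiveDeriv S.T S.vbar S.Rbar) N (Real.toNNReal P.α)
      (Cin * (amp P.β P.a P.b (S.q + 1) * Real.sqrt (amp P.β P.a P.b S.q) * freq P.a P.b S.q *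
        mollScale P.β P.α P.a P.b S.q ^ (-(N : ℝ) - P.α)))
  /-- (5.2) `δ_{q+1}/(2λ_q^α) ≤ e(t) - ∫ |v̄_q|² ≤ 2δ_{q+1}` on `[0,T]`. -/
  energy_gap : ∀ t ∈ Icc 0 S.T,
    amp P.β P.a P.b (S.q + 1) * freq P.a P.b S.q ^ (-P.α) / 2 ≤ S.e t - ∫ x, ‖S.vbar t x‖ ^ 2 ∧
      S.e t - ∫ x, ‖S.vbar t x‖ ^ 2 ≤ 2 * amp P.β P.a P.b (S.q + 1)

/-- The standing hypotheses with `N̄` derivatives imply those with fewer derivatives. [folklore] -/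
theorem PerturbationHypotheses.of_le {P : Params} {S : Setting} {Nbar Nbar' : ℕ} {Cin C₀ : ℝ}
    (H : PerturbationHypotheses P S Nbar Cin C₀) (h : Nbar' ≤ Nbar) :
    PerturbationHypotheses P S Nbar' Cin C₀ where
  pos_T := H.pos_T
  profile := H.profile
  eulerReynolds := H.eulerReynolds
  stress_support := H.stress_support
  velocity_sup := H.velocity_sup
  velocity N hN := H.velocity N (hN.trans h)
  stress N hN := H.stress N (hN.trans h)
  transport N hN := H.transport N (hN.trans h)
  energy_gap := H.energy_gap

/-- The construction data of §5 for a given setting: a family of squiggling cut-offs for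
`([0,T], τ_q)` with constants `(c₀, C_η)` and the backward flows `Φ_i` of `v̄_q` anchored at
`min(t_i, T)`, `t_i = iτ_q` (for `t_i ≤ T` this is BDSV's `Φ_i(·, t_i) = id`; cut-offs `η_i` with
`t_i > T` only see times `t ∈ (t_i - τ_q/3, T]`, within `τ_q/3` of the anchor).
[cite: BuckmasterEtAl2018, §5.2] -/
structure PerturbationData (P : Params) (S : Setting) (c₀ : ℝ) (Cη : ℕ → ℕ → ℝ) where
  /-- The cut-offs `η_i`. -/
  cut : CutoffFamily S.T (P.τ S.q) c₀ Cη
  /-- The backward flows `Φ_i = id + D_i` of `v̄_q`, anchored at `min (t_i, T)`. -/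
  flow : ∀ i : ℕ, FlowDisplacement S.T S.vbar (min ((i : ℝ) * P.τ S.q) S.T)

/-- The displacement family `D_i` of the construction data. [folklore] -/
def PerturbationData.D {P : Params} {S : Setting} {c₀ : ℝ} {Cη : ℕ → ℕ → ℝ}
    (𝒟 : PerturbationData P S c₀ Cη) : ℕ → ℝ → 𝕋³ → ℝ³ :=
  fun i => (𝒟.flow i).D

end Hypotheses

/-! ## The seven named facts -/

section Facts

/-- **Existence of Mikado flows** (BDSV Lemma 5.1 = Daneri–Székelyhidi 2017, Lemma 2.3: "For any
compact subset `𝒩 ⊂⊂ 𝒮₊^{3×3}` there exists a smooth vector field `W : 𝒩 × T³ → ℝ³` such that,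
for every `R ∈ 𝒩`, `div_ξ(W ⊗ W) = 0`, `div_ξ W = 0`, `⨍ W dξ = 0`, `⨍ W ⊗ W dξ = R`", with
the potential (5.9)), for the compact set `𝒩 = {R = Rᵀ : ‖R - Id‖_∞ ≤ 1/10} ⊂ 𝒮₊^{3×3}`, in the
form of a `BDSV.MikadoDatum`. The printed proof: Nash's geometric lemma `R = ∑_k Γ_k(R)² k ⊗ k`
(tree: `NashGeometric.geometric_lemma`) and disjoint periodic pipes `ψ_k` along the directions
`k`. [cite: BuckmasterEtAl2018, Lemma 5.1] -/
def mikado_exists : Prop :=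
  Nonempty (MikadoDatum mikadoRadius)

/-- **Existence of the squiggling cut-offs** (BDSV Lemma 5.3: "There exists cut-off functions
`{η_i}_i` with the properties (i)–(v) above and such that for any `i` and `n, m ≥ 0`,
`‖∂ₜⁿ η_i‖_m ≤ C(n,m) τ_q^{-n}`, where `C(n,m)` are geometric constants depending only upon `m`
and `n`"; (v) holds with "a positive geometric constant `c₀`"), for every horizon `T > 0` and
scale `τ > 0`, with `c₀` and `C(n,m)` independent of `T, τ`. [cite: BuckmasterEtAl2018, Lemma 5.3] -/
def cutoffs_exist : Prop :=
  ∃ c₀ : ℝ, 0 < c₀ ∧ ∃ Cη : ℕ → ℕ → ℝ, ∀ T τ : ℝ, 0 < T → 0 < τ →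
    Nonempty (CutoffFamily T τ c₀ Cη)

/-- **Existence of backward flows** (BDSV §5.2, the definition of `Φ_i`; App. B: smooth
solutions of transport equations along a smooth velocity field, "we will consider solutions on
the entire space `ℝ³` and treat solutions on the torus simply as periodic solutions"): for a
jointly smooth velocity field `v` on `[0,T] × T³` and `t₀ ∈ [0,T]` the transport problem
`(∂ₜ + v·∇)Φ = 0`, `Φ(·, t₀) = id` has a jointly smooth solution on `[0,T] × T³` of the form
`Φ = id + D` with `D` periodic (`BDSV.FlowDisplacement`; `Φ(·,t)` is the time-`t₀` position
along the flow of `v`, Lang 1995, IV §1). [cite: BuckmasterEtAl2018, §5.2 (Φ_i) and App. B] -/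
def backwardFlow_exists : Prop :=
  ∀ T : ℝ, 0 < T → ∀ v : ℝ → 𝕋³ → ℝ³, IsSmoothSpaceTimeOn (Icc 0 T) v →
    ∀ t₀ ∈ Icc 0 T, Nonempty (FlowDisplacement T v t₀)

/-- **The velocity increment bound** (BDSV Cor. 5.8, (5.31): "Assuming `a` is sufficiently
large, the perturbation `w_{q+1}` satisfies `‖w_{q+1}‖₀ + λ_{q+1}^{-1} ‖w_{q+1}‖₁ ≤ (M/2) δ_{q+1}^{1/2}`,
where the constant `M` depends solely on the constant `c₀` in (5.19)" — and on the Mikado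
profile, Remark 5.2, Lemma 5.5, Def. 5.6 `M = 64 M̄ ∑_{k≠0} |k|^{-4}`; the threshold for `a`
depends on `β, α, M` and the constants of the standing estimates, and needs
`b > (1 - β + 3α/2)/(1 - β)`, i.e. `α` small). Transcription: for every Mikado datum `𝔚` and
`c₀ > 0` there is `M = M(𝔚, c₀) > 0` such that for all cut-off constants `C_η`, all admissible
`β, b`, all `α < α₀(β, b)`, some `N̄`, all `C_in, C₀` and all `a ≥ a₀`, the perturbation
`w_{q+1}` (`BDSV.perturbation`) built from any data satisfying the standing hypotheses obeys
(5.31) = (2.23) (`BDSV.VelocityIncrementBound` with constant `M/2`).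
[cite: BuckmasterEtAl2018, Cor. 5.8 (5.31) and Def. 5.6] -/
def incrementEstimate : Prop :=
  ∀ (𝔚 : MikadoDatum mikadoRadius) (c₀ : ℝ), 0 < c₀ → ∃ M : ℝ, 0 < M ∧ ∀ Cη : ℕ → ℕ → ℝ,
    ∀ β : ℝ, 0 < β → β < 1 / 3 → ∀ b : ℝ, 1 < b → b < (1 - β) / (2 * β) →
      ∃ α₀ : ℝ, 0 < α₀ ∧ ∀ α : ℝ, 0 < α → α < α₀ → ∃ Nbar : ℕ, ∀ Cin C₀ : ℝ,
        ∃ a₀ : ℝ, 1 < a₀ ∧ ∀ a : ℝ, a₀ ≤ a → ∀ S : Setting,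
          PerturbationHypotheses ⟨β, α, a, b⟩ S Nbar Cin C₀ →
            ∀ 𝒟 : PerturbationData ⟨β, α, a, b⟩ S c₀ Cη,
              VelocityIncrementBound (M / 2) β a b S.T S.q
                (perturbation ⟨β, α, a, b⟩ S 𝔚 𝒟.cut.η 𝒟.D)

/-- **The new triple solves Euler–Reynolds** (BDSV §5.4: "With this definition [(5.23)] and
Proposition 4.1, one may verify that `∂ₜ v_{q+1} + div(v_{q+1} ⊗ v_{q+1}) + ∇p_{q+1} = div R̊_{q+1}`,
`div v_{q+1} = 0`", `R̊_{q+1}` symmetric and trace-free being in the range of `ℛ`, all terms of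
(5.23) of zero mean "of the form `ℛf`, where `f` is either a divergence or a curl"). The
verification uses `div ℛ f = f - ⨍f` (Prop. 4.1, tree: `Torus.tensorDivergence_antidivergence`),
`div w_{q+1} = 0` (a curl), `∑_i η_i² R̊̄_q = R̊̄_q` (by (2.17), (ii), (iii)), smoothness of all
ingredients and `ρ_q > 0` (Lemma 5.4 (5.15), which needs `a` large); the pressure is
`BDSV.newPressure`. Same quantifier prefix as the other stage facts. [cite: BuckmasterEtAl2018, §5.4 (5.23)–(5.24)] -/
def newTriple_isEulerReynolds : Prop :=
  ∀ (𝔚 : MikadoDatum mikadoRadius) (c₀ : ℝ), 0 < c₀ → ∀ Cη : ℕ → ℕ → ℝ,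
    ∀ β : ℝ, 0 < β → β < 1 / 3 → ∀ b : ℝ, 1 < b → b < (1 - β) / (2 * β) →
      ∃ α₀ : ℝ, 0 < α₀ ∧ ∀ α : ℝ, 0 < α → α < α₀ → ∃ Nbar : ℕ, ∀ Cin C₀ : ℝ,
        ∃ a₀ : ℝ, 1 < a₀ ∧ ∀ a : ℝ, a₀ ≤ a → ∀ S : Setting,
          PerturbationHypotheses ⟨β, α, a, b⟩ S Nbar Cin C₀ →
            ∀ 𝒟 : PerturbationData ⟨β, α, a, b⟩ S c₀ Cη,
              Torus.IsEulerReynoldsOn (Icc 0 S.T) (newVelocity ⟨β, α, a, b⟩ S 𝔚 𝒟.cut.η 𝒟.D)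
                (newPressure ⟨β, α, a, b⟩ S 𝒟.cut.η) (newStress ⟨β, α, a, b⟩ S 𝔚 𝒟.cut.η 𝒟.D)

/-- **The Reynolds stress estimate** (BDSV Prop. 6.1, (6.1): "The Reynolds stress error `R̊_{q+1}`
defined in (5.23) satisfies `‖R̊_{q+1}‖₀ ≲ δ_{q+1}^{1/2} δ_q^{1/2} λ_q / λ_{q+1}^{1-4α}`", the
implicit constant depending on `β, α, M`, the number `N` of derivatives chosen in §6.1.1 and the
constants of the standing estimates, for `a` sufficiently large; the proof is §6.1 — Nash,
transport and oscillation errors, each through the stationary phase estimate Prop. C.2 for `ℛ`).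
Transcription: same prefix as `BDSV.incrementEstimate`, with `∃ N̄` (§6.1.1: "`N` large enough")
and an explicit constant `C` fixed before `a₀`; `‖·‖₀` by `BDSV.SupLE`.
[cite: BuckmasterEtAl2018, Prop. 6.1 (6.1)] -/
def stressEstimate : Prop :=
  ∀ (𝔚 : MikadoDatum mikadoRadius) (c₀ : ℝ), 0 < c₀ → ∀ Cη : ℕ → ℕ → ℝ,
    ∀ β : ℝ, 0 < β → β < 1 / 3 → ∀ b : ℝ, 1 < b → b < (1 - β) / (2 * β) →
      ∃ α₀ : ℝ, 0 < α₀ ∧ ∀ α : ℝ, 0 < α → α < α₀ → ∃ Nbar : ℕ, ∀ Cin C₀ : ℝ,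
        ∃ C a₀ : ℝ, 1 < a₀ ∧ ∀ a : ℝ, a₀ ≤ a → ∀ S : Setting,
          PerturbationHypotheses ⟨β, α, a, b⟩ S Nbar Cin C₀ →
            ∀ 𝒟 : PerturbationData ⟨β, α, a, b⟩ S c₀ Cη,
              SupLE S.T (newStress ⟨β, α, a, b⟩ S 𝔚 𝒟.cut.η 𝒟.D)
                (C * (Real.sqrt (amp β a b (S.q + 1)) * Real.sqrt (amp β a b S.q) *
                  freq a b S.q * freq a b (S.q + 1) ^ (-1 + 4 * α)))

/-- **The energy estimate** (BDSV Prop. 6.2: "The energy of `v_{q+1}` satisfies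
`|e(t) - ∫_{T³} |v_{q+1}|² dx - δ_{q+2}/2| ≲ δ_q^{1/2} δ_{q+1}^{1/2} λ_q^{1+2α} / λ_{q+1}`",
for `t ∈ [0,T]`, the implicit constant as in Prop. 6.1, `a` sufficiently large; proof §6.2 via
`∑_i ∫ tr R_{q,i} = 3ρ_q`, (5.28) and the phase estimate (C.1) = (10.3)). Transcription as in
`BDSV.stressEstimate`. [cite: BuckmasterEtAl2018, Prop. 6.2] -/
def energyEstimate : Prop :=
  ∀ (𝔚 : MikadoDatum mikadoRadius) (c₀ : ℝ), 0 < c₀ → ∀ Cη : ℕ → ℕ → ℝ,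
    ∀ β : ℝ, 0 < β → β < 1 / 3 → ∀ b : ℝ, 1 < b → b < (1 - β) / (2 * β) →
      ∃ α₀ : ℝ, 0 < α₀ ∧ ∀ α : ℝ, 0 < α → α < α₀ → ∃ Nbar : ℕ, ∀ Cin C₀ : ℝ,
        ∃ C a₀ : ℝ, 1 < a₀ ∧ ∀ a : ℝ, a₀ ≤ a → ∀ S : Setting,
          PerturbationHypotheses ⟨β, α, a, b⟩ S Nbar Cin C₀ →
            ∀ 𝒟 : PerturbationData ⟨β, α, a, b⟩ S c₀ Cη,
              ∀ t ∈ Icc 0 S.T,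
                |S.e t - (∫ x, ‖newVelocity ⟨β, α, a, b⟩ S 𝔚 𝒟.cut.η 𝒟.D t x‖ ^ 2) -
                    amp β a b (S.q + 2) / 2| ≤
                  C * (Real.sqrt (amp β a b S.q) * Real.sqrt (amp β a b (S.q + 1)) *
                    freq a b S.q ^ (1 + 2 * α) * (freq a b (S.q + 1))⁻¹)

end Facts

/-! ## Assembly: the seven facts imply the perturbation stage -/

section Assembly

/-- The scale `δ_{q+1}^{1/2} δ_q^{1/2} λ_q λ_{q+1}^{-1+4α}` of (6.1) is nonnegative (`a ≥ 1`). [folklore] -/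
theorem stressScale_nonneg {β α a b : ℝ} (ha : 1 ≤ a) (q : ℕ) :
    0 ≤ Real.sqrt (amp β a b (q + 1)) * Real.sqrt (amp β a b q) * freq a b q *
      freq a b (q + 1) ^ (-1 + 4 * α) :=
  mul_nonneg (mul_nonneg (mul_nonneg (Real.sqrt_nonneg _) (Real.sqrt_nonneg _))
    (freq_pos ha q).le) (Real.rpow_nonneg (freq_pos ha (q + 1)).le _)

/-- The scale `δ_q^{1/2} δ_{q+1}^{1/2} λ_q^{1+2α} λ_{q+1}^{-1}` of Prop. 6.2 is nonnegative
(`a ≥ 1`). [folklore] -/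
theorem energyScale_nonneg {β α a b : ℝ} (ha : 1 ≤ a) (q : ℕ) :
    0 ≤ Real.sqrt (amp β a b q) * Real.sqrt (amp β a b (q + 1)) * freq a b q ^ (1 + 2 * α) *
      (freq a b (q + 1))⁻¹ :=
  mul_nonneg (mul_nonneg (mul_nonneg (Real.sqrt_nonneg _) (Real.sqrt_nonneg _))
    (Real.rpow_nonneg (freq_pos ha q).le _)) (inv_nonneg.2 (freq_pos ha (q + 1)).le)

/-- **Assembly of the perturbation stage from its parts** (BDSV §2.6: "Starting with the solution
`(v̄_q, p̄_q, R̊̄_q)` satisfying (2.17) and the estimates (2.18)–(2.22), we then produce a new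
solution `(v_{q+1}, p_{q+1}, R̊_{q+1})` of the Euler–Reynolds system with estimates (2.23)–(2.24c),
cf. Corollary 5.8 and Propositions 6.1 and 6.2"): given Mikado flows (Lemma 5.1), squiggling
cut-offs (Lemma 5.3) and backward flows (§5.2), the triple `(v̄_q + w_{q+1}, p_{q+1}, R̊_{q+1})`
of (5.28), (5.23) is an Euler–Reynolds triple (§5.4) satisfying (2.23) (Cor. 5.8), (2.24) = (6.1)
(Prop. 6.1) and (2.24c) (Prop. 6.2) — which is `BDSV.perturbationStage`. The universal constant
is the `M(𝔚, c₀)` of Cor. 5.8 for a fixed Mikado datum and the cut-off constant `c₀`; the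
thresholds `α₀`, `N̄`, `a₀` and the constant `C` are the extremal ones of the four estimates.
[cite: BuckmasterEtAl2018, §2.6 (2.23)–(2.24c)] -/
theorem perturbationStage_of_parts (h₁ : mikado_exists) (h₂ : cutoffs_exist)
    (h₃ : backwardFlow_exists) (h₄ : incrementEstimate) (h₅ : newTriple_isEulerReynolds)
    (h₆ : stressEstimate) (h₇ : energyEstimate) : perturbationStage := by
  obtain ⟨𝔚⟩ := h₁
  obtain ⟨c₀, hc₀, Cη, hcut⟩ := h₂
  obtain ⟨M, hM, h₄⟩ := h₄ 𝔚 c₀ hc₀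
  refine ⟨M, hM, ?_⟩
  intro β hβ hβ' b hb hb'
  obtain ⟨α₄, hα₄, h₄⟩ := h₄ Cη β hβ hβ' b hb hb'
  obtain ⟨α₅, hα₅, h₅⟩ := h₅ 𝔚 c₀ hc₀ Cη β hβ hβ' b hb hb'
  obtain ⟨α₆, hα₆, h₆⟩ := h₆ 𝔚 c₀ hc₀ Cη β hβ hβ' b hb hb'
  obtain ⟨α₇, hα₇, h₇⟩ := h₇ 𝔚 c₀ hc₀ Cη β hβ hβ' b hb hb'
  refine ⟨min (min α₄ α₅) (min α₆ α₇), lt_min (lt_min hα₄ hα₅) (lt_min hα₆ hα₇), ?_⟩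
  intro α hα hαlt
  have hα45 : α < min α₄ α₅ := lt_of_lt_of_le hαlt (min_le_left _ _)
  have hα67 : α < min α₆ α₇ := lt_of_lt_of_le hαlt (min_le_right _ _)
  obtain ⟨N₄, h₄⟩ := h₄ α hα (lt_of_lt_of_le hα45 (min_le_left _ _))
  obtain ⟨N₅, h₅⟩ := h₅ α hα (lt_of_lt_of_le hα45 (min_le_right _ _))
  obtain ⟨N₆, h₆⟩ := h₆ α hα (lt_of_lt_of_le hα67 (min_le_left _ _))
  obtain ⟨N₇, h₇⟩ := h₇ α hα (lt_of_lt_of_le hα67 (min_le_right _ _))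
  refine ⟨max (max N₄ N₅) (max N₆ N₇), ?_⟩
  intro Cin C₀
  obtain ⟨a₄, ha₄, h₄⟩ := h₄ Cin C₀
  obtain ⟨a₅, ha₅, h₅⟩ := h₅ Cin C₀
  obtain ⟨C₆, a₆, ha₆, h₆⟩ := h₆ Cin C₀
  obtain ⟨C₇, a₇, ha₇, h₇⟩ := h₇ Cin C₀
  refine ⟨max C₆ C₇, max (max a₄ a₅) (max a₆ a₇),
    lt_max_of_lt_left (lt_max_of_lt_left ha₄), ?_⟩
  intro a ha T hT e he q vbar pbar Rbar hER hsupp hsup hvel hstr htra hen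
  have ha45 : max a₄ a₅ ≤ a := le_trans (le_max_left _ _) ha
  have ha67 : max a₆ a₇ ≤ a := le_trans (le_max_right _ _) ha
  have ha1 : (1 : ℝ) ≤ a := le_trans ha₄.le (le_trans (le_max_left _ _) ha45)
  let P : Params := ⟨β, α, a, b⟩
  let S : Setting := ⟨T, e, q, vbar, pbar, Rbar⟩
  have H : PerturbationHypotheses P S (max (max N₄ N₅) (max N₆ N₇)) Cin C₀ :=
    ⟨hT, he, hER, hsupp, hsup, hvel, hstr, htra, hen⟩
  have hτ : 0 < P.τ S.q := glueScale_pos ha1 q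
  obtain ⟨cut⟩ := hcut T (P.τ S.q) hT hτ
  have hflow : ∀ i : ℕ, Nonempty (FlowDisplacement T vbar (min ((i : ℝ) * P.τ S.q) T)) :=
    fun i => h₃ T hT vbar hER.smooth_velocity _
      ⟨le_min (mul_nonneg i.cast_nonneg hτ.le) hT.le, min_le_right _ _⟩
  let 𝒟 : PerturbationData P S c₀ Cη := ⟨cut, fun i => Classical.choice (hflow i)⟩
  refine ⟨newVelocity P S 𝔚 𝒟.cut.η 𝒟.D, newPressure P S 𝒟.cut.η, newStress P S 𝔚 𝒟.cut.η 𝒟.D,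
    h₅ a (le_trans (le_max_right _ _) ha45) S
      (H.of_le (le_trans (le_max_right _ _) (le_max_left _ _))) 𝒟, ?_, ?_, ?_⟩
  · have hinc := h₄ a (le_trans (le_max_left _ _) ha45) S
      (H.of_le (le_trans (le_max_left _ _) (le_max_left _ _))) 𝒟
    have hw : (fun t x => newVelocity P S 𝔚 𝒟.cut.η 𝒟.D t x - vbar t x) =
        perturbation P S 𝔚 𝒟.cut.η 𝒟.D := by
      funext t x
      simp [newVelocity, S]
    rw [hw]
    exact hinc
  · have hst := h₆ a (le_trans (le_max_left _ _) ha67) S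
      (H.of_le (le_trans (le_max_left _ _) (le_max_right _ _))) 𝒟
    exact hst.mono (mul_le_mul_of_nonneg_right (le_max_left _ _) (stressScale_nonneg ha1 q))
  · intro t ht
    have hent := h₇ a (le_trans (le_max_right _ _) ha67) S
      (H.of_le (le_trans (le_max_right _ _) (le_max_right _ _))) 𝒟 t ht
    exact hent.trans (mul_le_mul_of_nonneg_right (le_max_right _ _) (energyScale_nonneg ha1 q))

end Assembly

end BDSV

end Literature.Analysis.FluidPDE
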